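import Literature.AlgebraicGeometry.Smoothening.DilatationDefect
import Literature.AlgebraicGeometry.Smoothening.DefectGenericRank
import Literature.AlgebraicGeometry.Dilatations.AffineDilatation
import HarnessLib

/-!
# The defect of smoothness drops under the dilatation: the affine dilatation `A[(ϖ, ḡ)/ϖ]`

Topic: `Literature/AlgebraicGeometry/Smoothening` (Bosch–Lütkebohmert–Raynaud, *Néron Models*,
§3.3 Prop. 5; M. Artin, *Néron Models*, Lemma (3.9)). `DilatationDefect` proves the inequality
`δ(a') + N ≤ δ(a) + p + rank_S a*Ω¹_{X/R}` for an abstract `A`-algebra `A'` with elements `zⱼ`,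
`ϖ zⱼ = ḡⱼ`, `ϖ` regular, `A' = A[z]`, and equal generic ranks. This file discharges these four
structural hypotheses for **the affine dilatation** `A' = A[𝔟/ϖ]`, `𝔟 = (ϖ, ḡ₁, …, ḡ_r)`
(`Dilatations.dilatation`, BLR §3.2), yielding the inequality for the dilatation itself
(`neronDefect_dilatation_add_le_of_centre`):

* for an `R`-algebra `B` (e.g. `R[T]`), `centreIdeal ϖ I g = (ϖ, ḡ₁, …, ḡ_r) ⊆ A = B/I` and `dilatationZ` — the elements
  `zⱼ = ḡⱼ/ϖ` of `A[𝔟/ϖ]`;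
* `algebraMap_mul_dilatationZ` (`ϖ zⱼ = ḡⱼ`), `isSMulRegular_dilatation` (`ϖ` regular, BLR 3.2/1:
  dilatations are flat), `adjoin_dilatationZ_eq_top` (`A[𝔟/ϖ] = A[z₁, …, z_r]`), and the generic
  rank via `DefectGenericRank` (`A[𝔟/ϖ][1/ϖ] = A[1/ϖ]`).

Also the density lemma of `DilatationDefect` is specialized to `A[𝔟/ϖ]`
(`mem_centreIdealB_of_injective_dilatation`). The remaining hypotheses of
`neronDefect_dilatation_add_le_of_centre` — the generator data of `I` and the independence of the
`dḡⱼ(a)` modulo `π` — are what the choice of the centre in BLR Lemma 3.3/4 provides; they are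
not produced here. No named facts (D-0026).

## References

* S. Bosch, W. Lütkebohmert, M. Raynaud, *Néron Models*, Springer 1990, §3.2 Prop. 1, §3.3
  Prop. 5. [BLRNeronModels1990] (Not held; numbers only.)
* M. Artin, *Néron Models*, in: G. Cornell, J. H. Silverman (eds.), *Arithmetic Geometry*,
  Springer 1986, Lemma (3.9) (pp. 226–227). [Artin1986NeronModels]
-/

noncomputable section

open scoped TensorProduct
open KaehlerDifferential MvPolynomial IsLocalization
open Literature.AlgebraicGeometry.Dilatations Literature.AlgebraicGeometry.Resolution

namespace Literature.AlgebraicGeometry.Smoothening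

universe u

section Centre

variable {R : Type u} [CommRing R] (ϖ : R) {B : Type u} [CommRing B] [Algebra R B]
  (I : Ideal B) {r : ℕ} (g : Fin r → B)

/-- **`zⱼ = ḡⱼ/ϖ ∈ A[𝔟/ϖ]`.** [folklore] -/
def dilatationZ (j : Fin r) : dilatation ϖ (centreIdeal ϖ I g) :=
  ⟨_, dilatation.div_mem ϖ (centreIdeal ϖ I g) (mk_mem_centreIdeal ϖ I g j)⟩

/-- **`ϖ zⱼ = ḡⱼ`** in `A[𝔟/ϖ]`. [folklore] -/
theorem algebraMap_mul_dilatationZ (j : Fin r) :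
    algebraMap R (dilatation ϖ (centreIdeal ϖ I g)) ϖ * dilatationZ ϖ I g j =
      algebraMap (B ⧸ I) (dilatation ϖ (centreIdeal ϖ I g))
        (Ideal.Quotient.mk I (g j)) := by
  apply Subtype.ext
  change algebraMap R (Localization.Away (algebraMap R (B ⧸ I) ϖ)) ϖ *
      (algebraMap _ _ (Ideal.Quotient.mk I (g j)) * Away.invSelf _) =
    algebraMap (B ⧸ I) _ (Ideal.Quotient.mk I (g j))
  rw [IsScalarTower.algebraMap_apply R (B ⧸ I) (Localization.Away _),
    mul_comm]
  exact div_mul_algebraMap _ _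

/-- **`ϖ` is regular on `A[𝔟/ϖ]`** (BLR 3.2/1: dilatations are flat; here: `ϖ` is a unit of
`A[1/ϖ] ⊇ A[𝔟/ϖ]`). [folklore] -/
theorem isSMulRegular_dilatation :
    IsSMulRegular (dilatation ϖ (centreIdeal ϖ I g))
      (algebraMap R (dilatation ϖ (centreIdeal ϖ I g)) ϖ) := fun _ _ h =>
  (mul_cancel_left_mem_nonZeroDivisors (dilatation.mem_nonZeroDivisors ϖ (centreIdeal ϖ I g))).mp h

/-- **`A[𝔟/ϖ] = A[z₁, …, z_r]`**: the dilatation algebra is generated over `A` by the `ḡⱼ/ϖ`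
(`y/ϖ = c₀ + Σ cⱼ zⱼ` for `y = c₀ ϖ + Σ cⱼ ḡⱼ ∈ 𝔟`). [folklore] -/
theorem adjoin_dilatationZ_eq_top :
    Algebra.adjoin (B ⧸ I) (Set.range (dilatationZ ϖ I g)) = ⊤ := by
  classical
  set A := B ⧸ I
  set Loc := Localization.Away (algebraMap R A ϖ)
  set A' := dilatation ϖ (centreIdeal ϖ I g)
  -- it suffices to compare the images in `Loc`
  apply Subalgebra.map_injective (f := A'.val) Subtype.val_injective
  rw [AlgHom.map_adjoin, Algebra.map_top, Subalgebra.range_val, ← Set.range_comp]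
  apply le_antisymm
  · refine Algebra.adjoin_le ?_
    rintro _ ⟨j, rfl⟩
    exact (dilatationZ ϖ I g j).2
  · -- every generator `y/ϖ`, `y ∈ 𝔟`, lies in `A[z]`
    change Algebra.adjoin A (blowupAlgebraGens (centreIdeal ϖ I g) (algebraMap R A ϖ)) ≤ _
    refine Algebra.adjoin_le ?_
    rintro _ ⟨y, hy, rfl⟩
    rw [centreIdeal, Ideal.span_insert] at hy
    obtain ⟨y₀, hy₀, y₁, hy₁, rfl⟩ := Submodule.mem_sup.mp hy
    obtain ⟨c₀, rfl⟩ := Ideal.mem_span_singleton'.mp hy₀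
    obtain ⟨c, rfl⟩ := (Ideal.mem_span_range_iff_exists_fun).mp hy₁
    rw [map_add, add_mul, map_mul, mul_assoc, Away.mul_invSelf, mul_one, map_sum, Finset.sum_mul]
    refine add_mem (Subalgebra.algebraMap_mem _ c₀) (Subalgebra.sum_mem _ fun j _ => ?_)
    rw [map_mul, mul_assoc]
    exact Subalgebra.mul_mem _ (Subalgebra.algebraMap_mem _ (c j))
      (Algebra.subset_adjoin ⟨j, rfl⟩)

/-! ### The density lemma for the affine dilatation -/

/-- `𝔟 · A[𝔟/ϖ] ⊆ (ϖ)` (in fact `=`, the exceptional divisor). [folklore] -/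
theorem map_centreIdeal_dilatation_le :
    (centreIdeal ϖ I g).map (algebraMap (B ⧸ I)
      (dilatation ϖ (centreIdeal ϖ I g))) ≤
      Ideal.span {algebraMap R (dilatation ϖ (centreIdeal ϖ I g)) ϖ} :=
  (dilatation.map_eq_span ϖ (centreIdeal ϖ I g) (algebraMap_mem_centreIdeal ϖ I g)).le

/-- **The density lemma for `A[𝔟/ϖ]`**: if `A/𝔟 → A[𝔟/ϖ]/(ϖ)` is injective and `I ⊆ 𝔟̃`, then
`f = ϖ f₀ + Σ gⱼ yⱼ ∈ I` with `yⱼ ∈ 𝔟̃` forces `f₀ ∈ 𝔟̃`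
(`DilatationDefect.mem_centreIdealB_of_injective`). [cite: Artin1986NeronModels, proof of Lemma (3.9), step (e), (3.12) (p. 227)] -/
theorem mem_centreIdealB_of_injective_dilatation
    (hinj : Function.Injective (Ideal.quotientMap
      (Ideal.span {algebraMap R (dilatation ϖ (centreIdeal ϖ I g)) ϖ})
      (algebraMap (B ⧸ I) (dilatation ϖ (centreIdeal ϖ I g)))
      (Ideal.map_le_iff_le_comap.mp (map_centreIdeal_dilatation_le ϖ I g))))
    (hI : I ≤ centreIdealB ϖ g) {f0 : B} {y : Fin r → B}
    (hy : ∀ j, y j ∈ centreIdealB ϖ g) (hf : algebraMap R B ϖ * f0 + ∑ j, g j * y j ∈ I) :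
    f0 ∈ centreIdealB ϖ g :=
  mem_centreIdealB_of_injective ϖ I (dilatation ϖ (centreIdeal ϖ I g)) g (dilatationZ ϖ I g)
    (algebraMap_mul_dilatationZ ϖ I g) (isSMulRegular_dilatation ϖ I g)
    (map_centreIdeal_dilatation_le ϖ I g) hinj hI hy hf

end Centre

section Point

variable {R : Type u} [CommRing R] (ϖ : R) {B : Type u} [CommRing B] [Algebra R B]
  (I : Ideal B) {r : ℕ} (g : Fin r → B)
  (S : Type u) [CommRing S] [IsDomain S] [IsDiscreteValuationRing S] [Algebra R S]
  [Algebra B S] [Algebra (B ⧸ I) S]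
  [Algebra (dilatation ϖ (centreIdeal ϖ I g)) S]
  [IsScalarTower R B S]
  [IsScalarTower B (B ⧸ I) S]
  [IsScalarTower R (B ⧸ I) S]
  [IsScalarTower (B ⧸ I) (dilatation ϖ (centreIdeal ϖ I g)) S]
  [IsScalarTower R (dilatation ϖ (centreIdeal ϖ I g)) S]

omit [IsDiscreteValuationRing S] [Algebra B S] [IsScalarTower R B S] [IsScalarTower B (B ⧸ I) S]
  [IsScalarTower R (dilatation ϖ (centreIdeal ϖ I g)) S] in
/-- **The generic rank is unchanged**: `rank_S (S ⊗_A Ω[A⁄R]) = rank_S (S ⊗_{A[𝔟/ϖ]} Ω[A[𝔟/ϖ]⁄R])`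
(`DefectGenericRank`, as `A[𝔟/ϖ][1/ϖ] = A[1/ϖ]`). [folklore] -/
theorem finrank_tensor_kaehler_dilatation_eq (hϖ : algebraMap R S ϖ ≠ 0) :
    Module.finrank S (S ⊗[B ⧸ I] Ω[(B ⧸ I)⁄R]) =
      Module.finrank S (S ⊗[dilatation ϖ (centreIdeal ϖ I g)]
        Ω[(dilatation ϖ (centreIdeal ϖ I g))⁄R]) := by
  haveI := dilatation.isLocalization_away ϖ (centreIdeal ϖ I g)
  exact finrank_tensor_kaehler_eq_of_subalgebra R ϖ (B ⧸ I)
    (Localization.Away (algebraMap R (B ⧸ I) ϖ))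
    (dilatation ϖ (centreIdeal ϖ I g)) Subtype.val_injective S hϖ

/-- **BLR Prop. 3.3/5 for the affine dilatation `X' = Spec A[(ϖ, ḡ)/ϖ] → X = Spec R[T]/I`**
(pointwise, from generator data): for compatible points `a : A → S`, `a' : A[𝔟/ϖ] → S` with values
in a discrete valuation ring `S` in which `ϖ` is a uniformizer, generator data `Fᵢ`, `Q_k` of
`I` as in `DilatationDefect` (generating `I` up to a multiplicative set `U` of elements invertible at
the point), and independent residues of the `dḡⱼ(a)`:
`δ(a') + rank_B Ω[B⁄R] ≤ δ(a) + p + rank_S a*Ω¹_{X/R}`. [cite: Artin1986NeronModels, Lemma (3.9) (p. 227)] -/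
theorem neronDefect_dilatation_add_finrank_le_of_centre [Module.Free B Ω[B⁄R]]
    [Module.Finite B Ω[B⁄R]] (hπ : Irreducible (algebraMap R S ϖ))
    (hγ : ∀ c : Fin r → S,
      (∃ y : S ⊗[B] Ω[B⁄R],
        ∑ j, c j • centreVec S g j = algebraMap R S ϖ • y) → ∀ j, algebraMap R S ϖ ∣ c j)
    {p : ℕ} (f0 : Fin p → B) (fc : Fin p → Fin r → B)
    (hf : ∀ i, algebraMap R B ϖ * f0 i + ∑ j, g j * fc i j ∈ I)
    {κ : Type} [Fintype κ] (q00 : κ → B)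
    (q0 : κ → Fin r → B) (qq : κ → Fin r → Fin r → B)
    (hq : ∀ k, algebraMap R B ϖ * algebraMap R B ϖ * q00 k + ∑ j, algebraMap R B ϖ * g j * q0 k j + ∑ j, ∑ l, g j * g l * qq k j l ∈ I)
    (U : Submonoid B) (hU : ∀ u ∈ U, IsUnit (algebraMap B S u))
    (hgen : ∀ f ∈ I, ∃ u ∈ U, u * f ∈
      Ideal.span (Set.range fun i => algebraMap R B ϖ * f0 i + ∑ j, g j * fc i j) ⊔
      Ideal.span (Set.range fun k =>
        algebraMap R B ϖ * algebraMap R B ϖ * q00 k + ∑ j, algebraMap R B ϖ * g j * q0 k j + ∑ j, ∑ l, g j * g l * qq k j l)) :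
    neronDefect R (dilatation ϖ (centreIdeal ϖ I g)) S + Module.finrank B Ω[B⁄R] ≤
      neronDefect R (B ⧸ I) S + p +
        Module.finrank S (S ⊗[B ⧸ I] Ω[(B ⧸ I)⁄R]) :=
  neronDefect_dilatation_add_finrank_le ϖ I (dilatation ϖ (centreIdeal ϖ I g)) g (dilatationZ ϖ I g)
    (algebraMap_mul_dilatationZ ϖ I g) S hπ (isSMulRegular_dilatation ϖ I g)
    (adjoin_dilatationZ_eq_top ϖ I g) (finrank_tensor_kaehler_dilatation_eq ϖ I g S hπ.ne_zero)
    hγ f0 fc hf q00 q0 qq hq U hU hgen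

end Point

/-! ### The polynomial case -/

section MvPolynomialCase

variable {R : Type u} [CommRing R] (ϖ : R) {N : ℕ} (I : Ideal (MvPolynomial (Fin N) R))
  {r : ℕ} (g : Fin r → MvPolynomial (Fin N) R)
  (S : Type u) [CommRing S] [IsDomain S] [IsDiscreteValuationRing S] [Algebra R S]
  [Algebra (MvPolynomial (Fin N) R) S] [Algebra (MvPolynomial (Fin N) R ⧸ I) S]
  [Algebra (dilatation ϖ (centreIdeal ϖ I g)) S]
  [IsScalarTower R (MvPolynomial (Fin N) R) S]
  [IsScalarTower (MvPolynomial (Fin N) R) (MvPolynomial (Fin N) R ⧸ I) S]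
  [IsScalarTower R (MvPolynomial (Fin N) R ⧸ I) S]
  [IsScalarTower (MvPolynomial (Fin N) R ⧸ I) (dilatation ϖ (centreIdeal ϖ I g)) S]
  [IsScalarTower R (dilatation ϖ (centreIdeal ϖ I g)) S]

/-- **BLR Prop. 3.3/5 for the affine dilatation `X' = Spec A[(ϖ, ḡ)/ϖ] → X = Spec R[T]/I`**
(pointwise, from generator data): for compatible points `a : A → S`, `a' : A[𝔟/ϖ] → S` with values
in a discrete valuation ring `S` in which `ϖ` is a uniformizer, generator data `Fᵢ`, `Q_k` of
`I` as in `DilatationDefect`, and independent residues of the `dḡⱼ(a)`: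
`δ(a') + N ≤ δ(a) + p + rank_S a*Ω¹_{X/R}`. [cite: Artin1986NeronModels, Lemma (3.9) (p. 227)] -/
theorem neronDefect_dilatation_add_le_of_centre (hπ : Irreducible (algebraMap R S ϖ))
    (hγ : ∀ c : Fin r → S,
      (∃ y : S ⊗[MvPolynomial (Fin N) R] Ω[MvPolynomial (Fin N) R⁄R],
        ∑ j, c j • centreVec S g j = algebraMap R S ϖ • y) → ∀ j, algebraMap R S ϖ ∣ c j)
    {p : ℕ} (f0 : Fin p → MvPolynomial (Fin N) R) (fc : Fin p → Fin r → MvPolynomial (Fin N) R)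
    (hf : ∀ i, C ϖ * f0 i + ∑ j, g j * fc i j ∈ I)
    {κ : Type} [Fintype κ] (q00 : κ → MvPolynomial (Fin N) R)
    (q0 : κ → Fin r → MvPolynomial (Fin N) R) (qq : κ → Fin r → Fin r → MvPolynomial (Fin N) R)
    (hq : ∀ k, C ϖ * C ϖ * q00 k + ∑ j, C ϖ * g j * q0 k j + ∑ j, ∑ l, g j * g l * qq k j l ∈ I)
    (hgen : I ≤ Ideal.span (Set.range fun i => C ϖ * f0 i + ∑ j, g j * fc i j) ⊔
      Ideal.span (Set.range fun k =>
        C ϖ * C ϖ * q00 k + ∑ j, C ϖ * g j * q0 k j + ∑ j, ∑ l, g j * g l * qq k j l)) :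
    neronDefect R (dilatation ϖ (centreIdeal ϖ I g)) S + N ≤
      neronDefect R (MvPolynomial (Fin N) R ⧸ I) S + p +
        Module.finrank S (S ⊗[MvPolynomial (Fin N) R ⧸ I] Ω[(MvPolynomial (Fin N) R ⧸ I)⁄R]) := by
  haveI : Nontrivial R := (algebraMap R S).domain_nontrivial
  haveI : Module.Free (MvPolynomial (Fin N) R) Ω[MvPolynomial (Fin N) R⁄R] :=
    Module.Free.of_basis (KaehlerDifferential.mvPolynomialBasis R (Fin N))
  have hNf : Module.finrank (MvPolynomial (Fin N) R) Ω[MvPolynomial (Fin N) R⁄R] = N := by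
    rw [Module.finrank_eq_card_basis (KaehlerDifferential.mvPolynomialBasis R (Fin N)),
      Fintype.card_fin]
  have h := neronDefect_dilatation_add_finrank_le_of_centre ϖ I g S hπ hγ f0 fc hf q00 q0 qq hq ⊥
    (fun u hu => by rw [Submonoid.mem_bot] at hu; rw [hu, map_one]; exact isUnit_one)
    (fun f hf' => ⟨1, Submonoid.one_mem _, by rw [one_mul]; exact hgen hf'⟩)
  rwa [hNf] at h

end MvPolynomialCase

end Literature.AlgebraicGeometry.Smoothening
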